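import Summits.QuantumFields.YangMills.Theorems.AlphaInputsT3ACv3ProfileThetaE
import Summits.QuantumFields.YangMills.Theorems.BalabanUVNodesN08AlphaProfileBuild
import HarnessLib

/-!
# `AlphaInputsT3ACv3ProfileBuildE` — STRATEGY B for 2′, (D6L)-CORE FORK, PART F5b′: THE BLENDED POTENTIAL AND THE PROFILE OVER THE **ENLARGED** REGIONS (scale-`k` layer
# included) — twin of NODE O's `…N08AlphaProfileBuild` §2 with the cut-offs `ProfileEnlarged.ThetaE` — lane `pub-balaban3d`, seat alpha-2 (g2)

WHAT (HOME `D6-AUDIT-alpha2-g2.md` §7, F5b′).  `wgtE j := θ′_j − θ′_{j+1}` (`j ≤ k`; `θ′` = `ProfileEnlarged.ThetaE` over `Ω′_j(h)`, width `R0·L^{j−1}`), the blended one-form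
`potZE := Σ_{j ≤ k} wgtE_j(proj x)·patPot (L^j) (amp j)` on `ℤ³` (NODE O's `blend` over `k + 1` scales), its torus periodicity, the torus one-form `potTE`, the profile
`profE := gexpCfg (potTE)`, ★ `liftCfg_profE` (the lift is the abelian configuration of `potZE`), `plaqVar_profE`, `dist1_plaqVar_profE_le` — verbatim twins of NODE O's
`wgt`/`potZ`/`potT`/`prof`/`liftCfg_prof`/`plaqVar_prof`/`dist1_plaqVar_prof_le` (its `amp`, `patPot`, `labZ`, periodicity lemmas reused BY NAME).  The regularity (F5c′), largeness
(F5d′) and near-reads smallness (F5e′) of `profE` are the successor's.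
HONEST FRAMING.  Kernel construction of a TEST configuration; nothing of [B10]∕[7]∕[4]'s estimates asserted; count-neutral helper toward R3 2′ (`stub_laneRecordsV3`, items 19935∕19936);
nothing about d = 4, the continuum, or a mass gap.

References: T. Bałaban, Commun. Math. Phys. 102 (1985) 255–275 [Balaban1985UV3] (p.256, (38)–(39) p.266); CMP 98 (1985) 17–51 [Balaban1985Averaging] ((9) p.18, (19)+(24) p.21).
-/

set_option autoImplicit false

noncomputable section

namespace Summit.QuantumFields.YangMills.Theorems.ProfileEnlarged

open scoped BigOperators Matrix.Norms.L2Operator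
open NormedSpace
open Literature.MathematicalPhysics.QuantumFieldTheory.Balaban1983to89
open Literature.MathematicalPhysics.QuantumFieldTheory.Balaban1985CMP102
open Literature.MathematicalPhysics.QuantumFieldTheory.Balaban1985CMP102.Setting
open Summit.QuantumFields.Balaban3D.Carriers
open Summit.QuantumFields.Balaban3D.Proofs.Primitives (AlphaConsts)
open Summit.QuantumFields.Balaban3D.Proofs.LiftBridge (liftCfg)
open Summit.QuantumFields.Balaban3D.Proofs.TorusLift (projSite projSite_add_e)
open Summit.QuantumFields.YangMills.Theorems.BalabanUVNodesN08AlphaRegSel (plaqVar)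
open Summit.QuantumFields.YangMills.Theorems.BalabanUVNodesN08AlphaLiftAvgCont (projSite_add_period)
open Summit.QuantumFields.YangMills.Theorems.BalabanUVNodesN08AlphaAbelianLift
open Summit.QuantumFields.YangMills.Theorems.BalabanUVNodesN08AlphaAbelianAverage
open Summit.QuantumFields.YangMills.Theorems.BalabanUVNodesN08AlphaPattern
open Summit.QuantumFields.YangMills.Theorems.BalabanUVNodesN08AlphaBlend
open Summit.QuantumFields.YangMills.Theorems.BalabanUVNodesN08AlphaProfileBuild (amp R0 labZ projSite_labZ patPot_add_of_dvd labZ_projSite_eq)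
open B7Prop1Explicit (e e_apply)

variable {L : ℕ} (S : Scales L) {G : Type} [GaugeGroup G] [MeasurableSpace G] {𝔊 : GroupModel G} (𝔠 : AlphaConsts L 𝔊.N)

section Potential

variable (X : Matrix (Fin 𝔊.N) (Fin 𝔊.N) ℂ) {k : ℕ} (h : Hist S.P k)

/-- The cut-off weights `ω′_j = θ′_j − θ′_{j+1}` over the enlarged regions (`j ≤ k`; `ω′_k = θ′_k` since `θ′_{k+1} = 0`). [folklore] -/
def wgtE (j : ℕ) (y : Site S.P 0) : ℝ :=
  ThetaE 𝔠.lane.carrier.M₁ (rcolOf S 𝔠.lane.carrier) R0 h j y - ThetaE 𝔠.lane.carrier.M₁ (rcolOf S 𝔠.lane.carrier) R0 h (j + 1) y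

/-- **THE BLENDED POTENTIAL OVER THE ENLARGED REGIONS ON `ℤ³`**: `Σ_{j ≤ k} ω′_j(proj x)·patPot (L^j) (amp j) (x, μ)` (a scale-`k` layer included). [folklore] -/
def potZE : B7Prop1Explicit.Site S.P.d → Fin S.P.d → ℝ :=
  blend (k + 1) (projSite (P := S.P)) (wgtE S 𝔠 h) (fun j => patPot (L ^ j) (amp S 𝔠 X j))

/-- **THE POTENTIAL IS PERIODIC WITH THE PERIOD OF `T_η`** in every coordinate (`k ≤ m + K`: `2L^j ∣ 2L^{m+K}` for `j ≤ k`). [cite: Balaban1985UV3, p.256 (torus)] -/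
theorem potZE_add_period (hk : k ≤ S.P.m + S.P.K) (x v : B7Prop1Explicit.Site S.P.d) (μ : Fin S.P.d) :
    potZE S 𝔠 X h (x + (S.P.sitesPerDir 0 : ℤ) • v) μ = potZE S 𝔠 X h x μ := by
  unfold potZE blend
  refine Finset.sum_congr rfl fun j hj => ?_
  rw [Finset.mem_range] at hj
  rw [projSite_add_period]
  congr 1
  refine patPot_add_of_dvd (L ^ j) _ x _ (fun i => ?_) μ
  rw [Pi.smul_apply, smul_eq_mul]
  refine Dvd.dvd.mul_right ?_ _
  have hP : S.P.sitesPerDir 0 = 2 * L ^ (S.P.m + S.P.K) := by simp [Params.sitesPerDir]; rfl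
  rw [hP]
  push_cast
  exact mul_dvd_mul_left 2 (pow_dvd_pow (L : ℤ) (by omega))

/-- **`potZE (lab (proj y)) = potZE y`.** [folklore] -/
theorem potZE_labZ_projSite (hk : k ≤ S.P.m + S.P.K) (y : B7Prop1Explicit.Site S.P.d) (μ : Fin S.P.d) :
    potZE S 𝔠 X h (labZ (projSite (P := S.P) y)) μ = potZE S 𝔠 X h y μ := by
  obtain ⟨v, hv⟩ := labZ_projSite_eq y
  rw [hv, potZE_add_period S 𝔠 X h hk]

/-- **THE TORUS ONE-FORM** over the enlarged regions: `b ↦ potZE (lab b₋, dir b)`. [folklore] -/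
def potTE : PBond S.P 0 → ℝ := fun b => potZE S 𝔠 X h (labZ b.src) b.dir

variable {X} (hX : X ∈ 𝔊.lie)

/-- **THE PROFILE OVER THE ENLARGED REGIONS**: the torus configuration `b ↦ gexp (potTE b)`. [cite: Balaban1985UV3, p.256] -/
def profE : GaugeField S.P 0 G := gexpCfg 𝔊 hX (potTE S 𝔠 X h)

/-- **THE LIFT OF THE PROFILE IS THE ABELIAN CONFIGURATION OF `potZE`.** [cite: Balaban1985UV3, p.256] -/
theorem liftCfg_profE (hk : k ≤ S.P.m + S.P.K) : liftCfg 𝔊 (profE S 𝔠 h hX) = abelCfg X (potZE S 𝔠 X h) := by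
  unfold profE
  rw [liftCfg_gexpCfg]
  congr 1
  funext y κ
  exact potZE_labZ_projSite S 𝔠 X h hk y κ

/-- **THE TORUS PLAQUETTE VARIABLES OF THE PROFILE ARE `gexp` OF THE CURL OF `potZE`.** [cite: Balaban1985Averaging, (9) p.18] -/
theorem plaqVar_profE (hk : k ≤ S.P.m + S.P.K) (y : Site S.P 0) (μ ν : Fin S.P.d) :
    plaqVar (profE S 𝔠 h hX) y μ ν = gexp 𝔊 hX (curl (potZE S 𝔠 X h) (labZ y) μ ν) := by
  have hsh : ∀ (y : Site S.P 0) (μ κ : Fin S.P.d), potTE S 𝔠 X h ⟨y.shift μ, κ⟩ = potZE S 𝔠 X h (labZ y + e μ) κ := by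
    intro y μ κ
    show potZE S 𝔠 X h (labZ (y.shift μ)) κ = _
    rw [← potZE_labZ_projSite S 𝔠 X h hk (labZ y + e μ) κ, projSite_add_e, projSite_labZ]
  have h0 : ∀ κ, potTE S 𝔠 X h ⟨y, κ⟩ = potZE S 𝔠 X h (labZ y) κ := fun κ => rfl
  unfold plaqVar
  simp only [profE, gexpCfg, gexp_inv, gexp_add, hsh, h0]
  congr 1

/-- Hence `dist1` of a torus plaquette of the profile is at most `|curl potZE|·‖X‖`. [cite: Balaban1985Averaging, (19)+(24) p.21] -/
theorem dist1_plaqVar_profE_le (hk : k ≤ S.P.m + S.P.K) (y : Site S.P 0) (μ ν : Fin S.P.d) :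
    dist1 (plaqVar (profE S 𝔠 h hX) y μ ν) ≤ |curl (potZE S 𝔠 X h) (labZ y) μ ν| * ‖X‖ := by
  rw [plaqVar_profE S 𝔠 h hX hk, 𝔊.dist1_eq, UnitaryModel.opDist1, rho_gexp]
  exact norm_exp_real_smul_sub_one_le (Summit.QuantumFields.Balaban3D.Proofs.GroupModelSkew.conjTranspose_eq_neg_of_mem_lie 𝔊 hX) _

/-- The weights are differences of consecutive cut-offs, hence in `[−1, 1]`; NON-NEGATIVE under the collar (N2′) (`ThetaE_succ_le`). [folklore] -/
theorem wgtE_nonneg (hd : S.P.d = 3) (hk : k ≤ S.P.m + S.P.K) (hRcol : ∀ j, j + 1 ≤ k → 39 * S.P.L + R0 + 8 ≤ rcolOf S 𝔠.lane.carrier j) (j : ℕ) (y : Site S.P 0) :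
    0 ≤ wgtE S 𝔠 h j y := by
  unfold wgtE
  have := ThetaE_succ_le 𝔠.lane.carrier.M₁ (rcolOf S 𝔠.lane.carrier) R0 h hd hk (by norm_num [R0]) hRcol j y
  linarith

/-- The weights telescope: `Σ_{j < j′} ω′_j(y) = θ′_0(y) − θ′_{j′}(y) ≤ 1`. [folklore] -/
theorem sum_wgtE_le_one (j' : ℕ) (y : Site S.P 0) : ∑ j ∈ Finset.range j', wgtE S 𝔠 h j y ≤ 1 := by
  have htel : ∀ n : ℕ, ∑ j ∈ Finset.range n, wgtE S 𝔠 h j y =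
      ThetaE 𝔠.lane.carrier.M₁ (rcolOf S 𝔠.lane.carrier) R0 h 0 y - ThetaE 𝔠.lane.carrier.M₁ (rcolOf S 𝔠.lane.carrier) R0 h n y := by
    intro n
    induction n with
    | zero => simp
    | succ n ih => rw [Finset.sum_range_succ, ih]; unfold wgtE; ring
  rw [htel, ThetaE_zero]
  linarith [(ThetaE_mem 𝔠.lane.carrier.M₁ (rcolOf S 𝔠.lane.carrier) R0 h j' y).1]

end Potential

end Summit.QuantumFields.YangMills.Theorems.ProfileEnlarged

end
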